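import Literature.Probability.RandomPlanarGeometry.LoewnerMapProofs
import HarnessLib

/-!
# Rohde–Schramm's derivative identities (3.3), (3.4) and (6.3) for the chordal Loewner flow

Trunk T-STOCH; third layer of the decomposition of the space-filling phase of SLE_κ
(`Literature.Probability.RandomPlanarGeometry.ae_isSpaceFilling_sleTrace_of_eight_le`, Rohde–Schramm, Ann. Math. 161 (2005),
Cor. 7.4 + Update), whose remaining probabilistic input is **Lemma 6.3** (p. 903): for
`z = x + iy ∈ ℍ` the limit `Z(z) = lim_{t ↑ τ(z)} y |gₜ'(z)| / Im gₜ(z)` exists a.s., and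
`Z(z) = ∞` a.s. iff `κ ≥ 8`. The printed proof of Lemma 6.3 starts from the *deterministic*
identity (p. 904, "From (3.9) we find that `∂ₜ log(|gₜ'(z)|/yₜ) = 4 yₜ² |zₜ|⁻⁴`, which implies")

  `(6.3)  Z = exp ∫₀^{τ(ẑ)} 4 yₜ² |zₜ|⁻⁴ dt`,  `zₜ = xₜ + i yₜ := gₜ(ẑ) - ξ(t)`,

"In particular, the limit in the definition of `Z` exists a.s." This file **proves** (6.3) in
its integrated form up to any time `t < τ(z)`, for the chordal Loewner chain of an *arbitrary
continuous driving function* `W` (`LoewnerChain.lean`: solutions `IsSolution`, swallowing time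
`T_z = swallowingTime W z`, Loewner map `gₜ = map W t`), from the explicit derivative
`gₜ'(z) = exp(-∫₀ᵗ 2 ds/(gₛ(z) - Wₛ)²)` of `LoewnerMapProofs` (`hasDerivAt_map`):

* `Literature.Probability.RandomPlanarGeometry.Loewner.isSolution_conj` — conjugation symmetry of the flow (`W` is real): if `g` solves
  from `z` then `ḡ` solves from `z̄`;
* `Literature.Probability.RandomPlanarGeometry.Loewner.IsSolution.im_eq_mul_exp` — **(3.4) integrated**:
  `Im g_b = (Im z) · exp(-∫₀ᵇ 2 ds/|gₛ - Wₛ|²)` (from `IsSolution.sub_eq_mul_exp` applied to the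
  pair `g, ḡ`: `g - ḡ = (z - z̄) exp ∫ -2/((g - W)(ḡ - W))`);
* `Literature.Probability.RandomPlanarGeometry.Loewner.norm_deriv_map_eq` — **(3.3) integrated**:
  `|gₜ'(z)| = exp ∫₀ᵗ Re(-2/(gₛ(z) - Wₛ)²) ds`;
* `Literature.Loewner.derivRatioRate W z s = 4 yₛ² / |zₛ|⁴` (the rate in (3.9)/(6.3)) and
  `Literature.Probability.RandomPlanarGeometry.Loewner.im_mul_norm_deriv_map_div_im_eq_exp` — **(6.3) up to time `t`**:
  `(Im z) |gₜ'(z)| / Im gₜ(z) = exp ∫₀ᵗ 4 yₛ² |zₛ|⁻⁴ ds` for `z ∈ ℍ`, `t < T_z`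
  (pointwise `Re(-2/zₛ²) + 2/|zₛ|² = 4 yₛ²/|zₛ|⁴`, `re_neg_two_div_mul_self_sub`);
* consequences: the ratio is `≥ 1` (`one_le_im_mul_norm_deriv_map_div_im`; cf. "`1 ≤ ŷ|g_T'(ẑ)|/y_T`",
  p. 905) and non-decreasing in `t` (`im_mul_norm_deriv_map_div_im_mono`), so that its limit as
  `t ↑ T_z` exists in `[1, ∞]` for every path (drawn in the SLE layer).

## Mathlib

We USE `intervalIntegral.integral_ofReal`, `ContinuousLinearMap.intervalIntegral_comp_comm`
(real part of an interval integral), `intervalIntegral.integral_sub/congr/mono_interval/nonneg`,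
`Complex.norm_exp`, `Complex.conjCLE` (derivative of `ḡ`). Mathlib has no Loewner chains.

## References

* S. Rohde, O. Schramm, *Basic properties of SLE*, Ann. of Math. 161 (2005) 883–924: eq. (2.1)
  (p. 886), eqs. (3.3), (3.4) (p. 890), (3.9) (p. 891), Lemma 6.3 and eq. (6.3) (pp. 903–904).
* G. F. Lawler, *Conformally Invariant Processes in the Plane*, AMS (2005), Ch. 4 §4.1.
-/

noncomputable section

open Set Filter Topology Metric MeasureTheory
open UpperHalfPlane (upperHalfPlaneSet isOpen_upperHalfPlaneSet)
open scoped NNReal ComplexConjugate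

namespace Literature.Probability.RandomPlanarGeometry

namespace Loewner

variable {W : ℝ≥0 → ℝ} {z : ℂ} {g : ℝ → ℂ} {T : WithTop ℝ≥0}

/-! ### Conjugation symmetry of the flow -/

/-- The Loewner field commutes with complex conjugation (the driving function is real):
`2/(w̄ - Wₜ) = conj (2/(w - Wₜ))`. [folklore] -/
theorem vectorField_conj (W : ℝ≥0 → ℝ) (t : ℝ) (w : ℂ) :
    vectorField W t (conj w) = conj (vectorField W t w) := by
  rw [vectorField_apply, vectorField_apply, map_div₀, map_sub, Complex.conj_ofReal, map_ofNat]

/-- **Conjugation symmetry of the Loewner flow**: if `g` solves the Loewner equation (2.1) driven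
by the real function `W` from `z`, then `ḡ` solves it from `z̄`, with the same lifetime (the
solution from a point of the lower half-plane is the mirror image of the one from its conjugate).
[folklore] -/
theorem isSolution_conj (h : IsSolution W z g T) :
    IsSolution W (conj z) (fun t ↦ conj (g t)) T := by
  refine ⟨by simp [h.apply_zero], fun t ht ↦ ?_, fun t ht htT h0 ↦ ?_⟩
  · have h2 : HasDerivWithinAt (fun t ↦ conj (g t)) (conj (vectorField W t (g t)))
        {t : ℝ | 0 ≤ t ∧ (t.toNNReal : WithTop ℝ≥0) < T} t :=
      Complex.conjCLE.hasFDerivAt.comp_hasDerivWithinAt t (h.isIntegralCurveOn t ht)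
    rwa [← vectorField_conj] at h2
  · apply h.ne ht htT
    have h2 := congrArg conj h0
    rwa [Complex.conj_conj, Complex.conj_ofReal] at h2

/-! ### (3.4): the imaginary part along the flow -/

/-- **Rohde–Schramm (2005), eq. (3.4), integrated**: along a solution `g` of the Loewner
equation from `z` (continuous driving function), `Im g_b = (Im z) · exp(∫₀ᵇ -2/|gₛ - Wₛ|² ds)`
for `0 ≤ b < T` ((3.4): "`∂ₜ log Im gₜ(z) = -2 |gₜ(z) - ξ(t)|⁻²`", p. 890). Proof: apply
`IsSolution.sub_eq_mul_exp` to the solutions `ḡ` (from `z̄`, `isSolution_conj`) and `g`: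
`g_b - ḡ_b = (z - z̄) exp ∫₀ᵇ -2/((gₛ - Wₛ)(ḡₛ - Wₛ)) = (z - z̄) exp ∫₀ᵇ -2/|gₛ - Wₛ|²`, and take
imaginary parts. [cite: RohdeSchramm2005, eq. (3.4)] -/
theorem IsSolution.im_eq_mul_exp (hW : Continuous W) (h : IsSolution W z g T) {b : ℝ}
    (hb0 : 0 ≤ b) (hb : (b.toNNReal : WithTop ℝ≥0) < T) :
    (g b).im = z.im * Real.exp (∫ s in (0:ℝ)..b, -2 / Complex.normSq (g s - W s.toNNReal)) := by
  have hid := (isSolution_conj h).sub_eq_mul_exp hW h hb0 hb hb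
  have hint : (∫ s in (0:ℝ)..b, -2 / ((g s - W s.toNNReal) * (conj (g s) - W s.toNNReal))) =
      ((∫ s in (0:ℝ)..b, -2 / Complex.normSq (g s - W s.toNNReal) : ℝ) : ℂ) := by
    rw [← intervalIntegral.integral_ofReal]
    refine intervalIntegral.integral_congr fun s _ ↦ ?_
    rw [show conj (g s) - (W s.toNNReal : ℂ) = conj (g s - W s.toNNReal) by
      rw [map_sub, Complex.conj_ofReal], Complex.mul_conj]
    push_cast
    rfl
  rw [hint, ← Complex.ofReal_exp] at hid
  have := congrArg Complex.im hid
  simp only [Complex.sub_im, Complex.conj_im, sub_neg_eq_add, Complex.im_mul_ofReal] at this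
  linarith

/-! ### (3.3): the modulus of the derivative -/

/-- **Rohde–Schramm (2005), eq. (3.3), integrated**: `|gₜ'(z)| = exp ∫₀ᵗ Re(-2/(gₛ(z) - Wₛ)²) ds`
for `t < T_z` ((3.3): "`∂ₜ log|gₜ'(z)| = -2 Re((gₜ(z) - ξ(t))⁻²)`", p. 890), from the explicit
derivative `gₜ'(z) = exp(-∫₀ᵗ 2 ds/(gₛ(z) - Wₛ)²)` (`hasDerivAt_map`) and `|exp w| = exp (Re w)`.
[cite: RohdeSchramm2005, eq. (3.3)] -/
theorem norm_deriv_map_eq (hW : Continuous W) {t : ℝ≥0}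
    (hz : (t : WithTop ℝ≥0) < swallowingTime W z) (hg : IsSolution W z g (swallowingTime W z)) :
    ‖deriv (map W t) z‖ =
      Real.exp (∫ s in (0:ℝ)..t, (-2 / ((g s - W s.toNNReal) * (g s - W s.toNNReal))).re) := by
  rw [(hasDerivAt_map hW hz hg).deriv, Complex.norm_exp]
  congr 1
  have hint : IntervalIntegrable (fun s ↦ -2 / ((g s - W s.toNNReal) * (g s - W s.toNNReal)))
      volume 0 t :=
    ((hg.continuousOn_coeff hW hg (toNNReal_coe_lt hz) (toNNReal_coe_lt hz)).mono
      (by rw [uIcc_of_le t.coe_nonneg])).intervalIntegrable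
  have := Complex.reCLM.intervalIntegral_comp_comm hint
  simpa using this.symm

/-! ### The rate `4 y² / |z|⁴` and eq. (6.3) -/

/-- Pointwise identity behind (3.9)/(6.3): for `Z = x + iy ≠ 0`,
`Re(-2/Z²) - (-2/|Z|²) = 4 y² / |Z|⁴` (`-2(x² - y²) + 2(x² + y²) = 4y²`). Rohde–Schramm (2005),
(3.9) ("The latter easily follows from (3.3) and (3.4)", p. 891). [cite: RohdeSchramm2005, eq. (3.9)] -/
theorem re_neg_two_div_mul_self_sub (Z : ℂ) (hZ : Z ≠ 0) :
    (-2 / (Z * Z)).re - (-2 / Complex.normSq Z) = 4 * Z.im ^ 2 / ‖Z‖ ^ 4 := by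
  have hn : Complex.normSq Z ≠ 0 := (Complex.normSq_pos.2 hZ).ne'
  have h4 : ‖Z‖ ^ 4 = Complex.normSq Z ^ 2 := by rw [Complex.normSq_eq_norm_sq]; ring
  rw [h4, Complex.div_re, Complex.normSq_mul]
  simp only [Complex.neg_re, Complex.neg_im, Complex.re_ofNat, Complex.im_ofNat, Complex.mul_re,
    Complex.mul_im, neg_zero, zero_mul, zero_div, add_zero]
  rw [Complex.normSq_apply] at *
  field_simp
  ring

/-- **Rohde–Schramm's rate `4 yₛ² / |zₛ|⁴`**, `zₛ = xₛ + i yₛ := gₛ(z) - Wₛ` (Rohde–Schramm (2005),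
eq. (3.9): `d log ψ = 4y²/(x² + y²)² dt`, and eq. (6.3)), as a function of real time `s`
(clamped to `ℝ≥0`) in terms of the Loewner map `gₛ = map W s`; meaningful for `0 ≤ s < T_z`
(junk afterwards, from the junk value of `map`). [cite: RohdeSchramm2005, eq. (6.3)] -/
def derivRatioRate (W : ℝ≥0 → ℝ) (z : ℂ) (s : ℝ) : ℝ :=
  4 * (map W s.toNNReal z - W s.toNNReal).im ^ 2 / ‖map W s.toNNReal z - W s.toNNReal‖ ^ 4

/-- Unfolding lemma for `derivRatioRate`. [folklore] -/
theorem derivRatioRate_apply (W : ℝ≥0 → ℝ) (z : ℂ) (s : ℝ) :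
    derivRatioRate W z s =
      4 * (map W s.toNNReal z - W s.toNNReal).im ^ 2 / ‖map W s.toNNReal z - W s.toNNReal‖ ^ 4 :=
  rfl

/-- The rate is non-negative. [folklore] -/
theorem derivRatioRate_nonneg (W : ℝ≥0 → ℝ) (z : ℂ) (s : ℝ) : 0 ≤ derivRatioRate W z s := by
  rw [derivRatioRate_apply]
  positivity

/-- Along a solution `g` from `z` (continuous driving function) the rate is
`4 (Im(g s - W s))² / ‖g s - W s‖⁴` (`map_eq_of_isSolution`). [folklore] -/
theorem derivRatioRate_eq_of_isSolution (hW : Continuous W) (hg : IsSolution W z g T) {s : ℝ}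
    (hs0 : 0 ≤ s) (hs : (s.toNNReal : WithTop ℝ≥0) < T) :
    derivRatioRate W z s = 4 * (g s - W s.toNNReal).im ^ 2 / ‖g s - W s.toNNReal‖ ^ 4 := by
  rw [derivRatioRate_apply, map_eq_of_isSolution hW hg hs, Real.coe_toNNReal _ hs0]

/-- The rate is continuous on every compact time interval `[0, b]` with `b < T_z` (the solution is
continuous and stays off the driving function there). [folklore] -/
theorem continuousOn_derivRatioRate (hW : Continuous W) {b : ℝ}
    (hb : (b.toNNReal : WithTop ℝ≥0) < swallowingTime W z) :
    ContinuousOn (derivRatioRate W z) (Icc 0 b) := by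
  rcases lt_or_ge b 0 with hb0 | hb0
  · rw [Icc_eq_empty_of_lt hb0]
    exact continuousOn_empty _
  have hz : z ≠ W 0 := by
    refine ne_driving_of_lt_swallowingTime (t := (b.toNNReal : WithTop ℝ≥0)) ?_
    exact hb
  obtain ⟨g, hg⟩ := exists_isSolution_swallowingTime_holds hW hz
  have hsub := Icc_subset_timeDomain (T := swallowingTime W z) hb
  have hWc : Continuous fun s : ℝ ↦ (W s.toNNReal : ℂ) :=
    Complex.continuous_ofReal.comp (hW.comp continuous_real_toNNReal)
  have hZ : ContinuousOn (fun s ↦ g s - (W s.toNNReal : ℂ)) (Icc 0 b) :=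
    (hg.continuousOn.mono hsub).sub hWc.continuousOn
  have hne : ∀ s ∈ Icc 0 b, g s - (W s.toNNReal : ℂ) ≠ 0 := fun s hs ↦
    sub_ne_zero.2 (hg.ne hs.1 (hsub hs).2)
  have hcont : ContinuousOn (fun s ↦ 4 * (g s - W s.toNNReal).im ^ 2 / ‖g s - W s.toNNReal‖ ^ 4)
      (Icc 0 b) :=
    (continuousOn_const.mul ((Complex.continuous_im.comp_continuousOn hZ).pow 2)).div
      (hZ.norm.pow 4) fun s hs ↦ pow_ne_zero 4 (norm_ne_zero_iff.2 (hne s hs))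
  exact hcont.congr fun s hs ↦ derivRatioRate_eq_of_isSolution hW hg hs.1 (hsub hs).2

/-- The rate is interval integrable on `[0, t]` for `t < T_z`. [folklore] -/
theorem intervalIntegrable_derivRatioRate (hW : Continuous W) {t : ℝ≥0}
    (hz : (t : WithTop ℝ≥0) < swallowingTime W z) :
    IntervalIntegrable (derivRatioRate W z) volume 0 t :=
  ((continuousOn_derivRatioRate hW (toNNReal_coe_lt hz)).mono
    (by rw [uIcc_of_le t.coe_nonneg])).intervalIntegrable

/-- **Rohde–Schramm (2005), eq. (6.3), up to time `t`**: for a continuous driving function,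
`z ∈ ℍ` and `t < T_z`,
`(Im z) · |gₜ'(z)| / Im gₜ(z) = exp ∫₀ᵗ 4 yₛ² |zₛ|⁻⁴ ds` (`zₛ = gₛ(z) - Wₛ = xₛ + i yₛ`);
printed as "`∂ₜ log(|gₜ'(z)|/yₜ) = 4 yₜ² |zₜ|⁻⁴`, which implies (6.3)" (p. 904) and as
`d log ψ = 4y² (x² + y²)⁻² dt` in (3.9) (p. 891). Proof: divide (3.3) by (3.4)
(`norm_deriv_map_eq`, `IsSolution.im_eq_mul_exp`) and use `re_neg_two_div_mul_self_sub` under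
the integral. [cite: RohdeSchramm2005, eq. (6.3)] -/
theorem im_mul_norm_deriv_map_div_im_eq_exp (hW : Continuous W) (hzim : 0 < z.im) {t : ℝ≥0}
    (hz : (t : WithTop ℝ≥0) < swallowingTime W z) :
    z.im * ‖deriv (map W t) z‖ / (map W t z).im =
      Real.exp (∫ s in (0:ℝ)..t, derivRatioRate W z s) := by
  obtain ⟨g, hg⟩ := exists_isSolution_swallowingTime_holds hW (ne_driving_of_lt_swallowingTime hz)
  have htT := toNNReal_coe_lt hz
  have hsub := Icc_subset_timeDomain (T := swallowingTime W z) htT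
  rw [norm_deriv_map_eq hW hz hg, map_eq_of_isSolution hW hg hz,
    hg.im_eq_mul_exp hW t.coe_nonneg htT, mul_div_mul_left _ _ hzim.ne', ← Real.exp_sub]
  congr 1
  -- continuity of the two integrands on `[0, t]`
  have hWc : Continuous fun s : ℝ ↦ (W s.toNNReal : ℂ) :=
    Complex.continuous_ofReal.comp (hW.comp continuous_real_toNNReal)
  have hZ : ContinuousOn (fun s ↦ g s - (W s.toNNReal : ℂ)) (Icc 0 t) :=
    (hg.continuousOn.mono hsub).sub hWc.continuousOn
  have hne : ∀ s ∈ Icc (0:ℝ) t, g s - (W s.toNNReal : ℂ) ≠ 0 := fun s hs ↦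
    sub_ne_zero.2 (hg.ne hs.1 (hsub hs).2)
  have hA : IntervalIntegrable
      (fun s ↦ (-2 / ((g s - W s.toNNReal) * (g s - W s.toNNReal))).re) volume 0 t := by
    refine (ContinuousOn.mono ?_ (by rw [uIcc_of_le t.coe_nonneg])).intervalIntegrable
    exact Complex.continuous_re.comp_continuousOn (hg.continuousOn_coeff hW hg htT htT)
  have hB : IntervalIntegrable (fun s ↦ -2 / Complex.normSq (g s - W s.toNNReal)) volume 0 t := by
    refine (ContinuousOn.mono ?_ (by rw [uIcc_of_le t.coe_nonneg])).intervalIntegrable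
    exact continuousOn_const.div (Complex.continuous_normSq.comp_continuousOn hZ) fun s hs ↦
      (Complex.normSq_pos.2 (hne s hs)).ne'
  rw [← intervalIntegral.integral_sub hA hB]
  refine intervalIntegral.integral_congr fun s hs ↦ ?_
  rw [uIcc_of_le t.coe_nonneg] at hs
  rw [re_neg_two_div_mul_self_sub _ (hne s hs),
    derivRatioRate_eq_of_isSolution hW hg hs.1 (hsub hs).2]

/-- The integrated rate is non-negative. [folklore] -/
theorem integral_derivRatioRate_nonneg (W : ℝ≥0 → ℝ) (z : ℂ) {t : ℝ} (ht : 0 ≤ t) :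
    0 ≤ ∫ s in (0:ℝ)..t, derivRatioRate W z s :=
  intervalIntegral.integral_nonneg ht fun s _ ↦ derivRatioRate_nonneg W z s

/-- The integrated rate is non-decreasing in the upper limit, before the swallowing time.
[folklore] -/
theorem integral_derivRatioRate_mono (hW : Continuous W) {s t : ℝ≥0} (hst : s ≤ t)
    (hz : (t : WithTop ℝ≥0) < swallowingTime W z) :
    ∫ u in (0:ℝ)..s, derivRatioRate W z u ≤ ∫ u in (0:ℝ)..t, derivRatioRate W z u :=
  intervalIntegral.integral_mono_interval le_rfl s.coe_nonneg (NNReal.coe_le_coe.2 hst)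
    (Filter.Eventually.of_forall fun u ↦ derivRatioRate_nonneg W z u)
    (intervalIntegrable_derivRatioRate hW hz)

/-- **`1 ≤ (Im z) |gₜ'(z)| / Im gₜ(z)`** for `z ∈ ℍ` and `t < T_z` (by (6.3), the rate being
non-negative); Rohde–Schramm (2005), proof of Lemma 6.3: "Note that `1 ≤ ŷ |g_T'(ẑ)|/y_T < Z`"
(p. 905). [cite: RohdeSchramm2005, Lemma 6.3] -/
theorem one_le_im_mul_norm_deriv_map_div_im (hW : Continuous W) (hzim : 0 < z.im) {t : ℝ≥0}
    (hz : (t : WithTop ℝ≥0) < swallowingTime W z) :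
    1 ≤ z.im * ‖deriv (map W t) z‖ / (map W t z).im := by
  rw [im_mul_norm_deriv_map_div_im_eq_exp hW hzim hz]
  exact Real.one_le_exp (integral_derivRatioRate_nonneg W z t.coe_nonneg)

/-- **The ratio `(Im z) |gₜ'(z)| / Im gₜ(z)` is non-decreasing in `t < T_z`** (by (6.3));
Rohde–Schramm (2005), proof of Lemma 6.3 (p. 904: `∂ₜ log(|gₜ'(z)|/yₜ) = 4 yₜ² |zₜ|⁻⁴ ≥ 0`).
[cite: RohdeSchramm2005, eq. (6.3)] -/
theorem im_mul_norm_deriv_map_div_im_mono (hW : Continuous W) (hzim : 0 < z.im) {s t : ℝ≥0}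
    (hst : s ≤ t) (hz : (t : WithTop ℝ≥0) < swallowingTime W z) :
    z.im * ‖deriv (map W s) z‖ / (map W s z).im ≤
      z.im * ‖deriv (map W t) z‖ / (map W t z).im := by
  have hs : (s : WithTop ℝ≥0) < swallowingTime W z :=
    lt_of_le_of_lt (WithTop.coe_le_coe.2 hst) hz
  rw [im_mul_norm_deriv_map_div_im_eq_exp hW hzim hs,
    im_mul_norm_deriv_map_div_im_eq_exp hW hzim hz]
  exact Real.exp_le_exp.2 (integral_derivRatioRate_mono hW hst hz)

end Loewner

end Literature.Probability.RandomPlanarGeometry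

end
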